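import Literature.Analysis.FluidPDE.MVRelativeEnergyIntegrands
import HarnessLib

/-!
# BF18 shell for functions (crux `ChaosClosesEuler`, stmt-AtomisticToContinuum-15141, line `Sketch`,
# stub `stub_bf18Shell`) — helper 3a: the clamped relative energy and the reduced right-hand side in
# the far field, for a CONSTANT value of the entropy cut-off

WHAT. For the deterministic BF18 shell (genuine fields, no entropy minimum principle) the cut-off value at a
state is a real `ζ ∈ [a, b]` that is NOT always `clamp a b (s)` of the state's junk entropy (cold states
`ϑ = 0` carry `ζ = a`, the vacuum carries anything); every pointwise identity of the tree is therefore used with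
the constant cut-off `fun _ => ζ`. This file records, for such a constant cut-off,

* `relEnergyZ_const_kinetic_form` — BF (3.4) regrouped: `ℰ_ζ = |m − ρU|²/(2ρ) + E + ρ(−μ̃ − Θ̃ζ) + p̃`
  (`E` the INTERNAL energy density), the form that is manifestly coercive when `−μ̃ − Θ̃ζ ≥ 1`;
* `relEnergyZ_vacuum`, `reducedRHS_vacuum` — on the vacuum `ℰ_Z = E + p̃` and `reducedRHS = p̃ divU + Dₜp̃`;
* `far_const_coercive` — the linear coercivity `1 + ρ + E ≤ max(1,1/p₀)(ℰ_ζ − ρ|v|²/2)` when `−μ̃ − Θ̃ζ ≥ 1`, `p̃ ≥ p₀ > 0`;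
* `reducedRHS_le_far_const` — the residual ("far-field") bound of the reduced right-hand side (BF (3.9)) by
  `C · (ρ|v|²/2 + R)` for ANY `R ≥ 0` dominating `1 + ρ + E` linearly, under the pressure growth `|p| ≤ c_g E`
  valid for the monatomic excess class (`|p| = ρϑ|χ| ≤ Bρϑ = (2B/3)·ρe`); density `ρ ≥ 0` (vacuum allowed).

WHY. On states with entropy below the lower clamp level `a` the clamped relative energy `ℰ_Z = ℰ + Θ̃ρ(s − a)`
is BELOW the full relative energy `ℰ`, so the tree's master inequality `reducedRHS ≤ Cℰ` is useless there;
instead one bounds `reducedRHS` directly by `1 + ρ + E + ρ|v|²` (the cut-off value being the bounded constant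
`a`) and uses the explicit coercive form of `ℰ_Z`.

No named fact is invoked.
-/

noncomputable section

namespace Summit.AtomisticToContinuum.HydrodynamicLimit.Theorems.ChaosClosesEulerShell

open Set Function Finset
open scoped BigOperators
open Literature.Analysis.FluidPDE Literature.Analysis.FluidPDE.CompressibleEuler
open Literature.Analysis.FluidPDE.CompressibleEuler.StrongPointData
open Literature.Analysis.FluidPDE.CompressibleEuler.EulerPhase
open Literature.Analysis.FluidPDE.CompressibleEuler.EulerEOS

variable {eos : EulerEOS}

/-! ## The clamped relative energy with a constant cut-off value -/

/-- **BF (3.4) regrouped.** For a constant cut-off value `ζ` and a state `(ρ, E, m)` with `ρ ≠ 0`: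
`ℰ_ζ = ∑ᵢ(mᵢ − ρUᵢ)²/(2ρ) + E + ρ(−μ(r,Θ) − Θζ) + p(r,Θ)`. [cite: BrezinaFeireisl2018, (3.4)] -/
theorem relEnergyZ_const_kinetic_form (d : StrongPointData) (ζ : ℝ) {ρ : ℝ} (hρ : ρ ≠ 0) (E : ℝ)
    (m : EuclideanSpace ℝ (Fin 3)) :
    d.relEnergyZ eos (fun _ => ζ) (ρ, E, m) =
      (∑ i, (m i - ρ * d.U i) ^ 2) / (2 * ρ) + E +
        ρ * (-eos.chemPotential d.r d.Θ - d.Θ * ζ) + eos.p d.r d.Θ := by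
  have hn1 : ‖m‖ ^ 2 = ∑ i, m i ^ 2 := by rw [EuclideanSpace.real_norm_sq_eq]
  have hn2 : ‖d.U‖ ^ 2 = ∑ i, d.U i ^ 2 := by rw [EuclideanSpace.real_norm_sq_eq]
  unfold relEnergyZ kineticEnergy
  simp only [dens_mk, ien_mk, mom_mk, hn1, hn2, Fin.sum_univ_three]
  field_simp
  ring

/-- The kinetic part `∑ᵢ(mᵢ − ρUᵢ)²/(2ρ) = ρ/2 · ∑ᵢ (mᵢ/ρ − Uᵢ)²` (`ρ ≠ 0`). [folklore] -/
theorem kinetic_rel_eq (d : StrongPointData) {ρ : ℝ} (hρ : ρ ≠ 0) (m : EuclideanSpace ℝ (Fin 3)) :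
    (∑ i, (m i - ρ * d.U i) ^ 2) / (2 * ρ) = ρ * (∑ i, (m i / ρ - d.U i) ^ 2) / 2 := by
  rw [kinetic_eq d hρ m]; ring

/-- **The clamped relative energy on the vacuum**: `ℰ_Z(0, E, 0) = E + p(r,Θ)` for every cut-off `Z`.
[cite: BrezinaFeireisl2018, (3.4)] -/
theorem relEnergyZ_vacuum (d : StrongPointData) (Z : ℝ → ℝ) (E : ℝ) :
    d.relEnergyZ eos Z ((0 : ℝ), E, (0 : EuclideanSpace ℝ (Fin 3))) = E + eos.p d.r d.Θ := by
  unfold relEnergyZ kineticEnergy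
  simp

/-- **The reduced right-hand side on the vacuum**: `p̃ divU + ∂ₜp̃ + U·∇p̃` for every cut-off, provided
`p(0, ·) = 0`. [cite: BrezinaFeireisl2018, (3.9)] -/
theorem reducedRHS_vacuum (d : StrongPointData) (Z : ℝ → ℝ) (E : ℝ) (hr : d.r ≠ 0)
    (hp0 : ∀ θ, eos.p 0 θ = 0) :
    reducedRHS eos Z d 0 E 0 =
      eos.p d.r d.Θ * d.divU + (d.pt eos + ∑ j, d.U j * d.gp eos j) := by
  unfold reducedRHS
  simp only [hp0, PiLp.zero_apply, zero_div, zero_sub, zero_mul, sub_zero, neg_zero, zero_add,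
    add_zero]
  field_simp
  ring

/-! ## The far-field bound for a constant cut-off value -/

/-- **Far-field bound of the reduced right-hand side, constant cut-off value.** For strong data bounded by
`M` with `|p(r,Θ)| ≤ P_k`, `|s(r,Θ)|, |∂p(r,Θ)| ≤ S_k`, `r ≥ r_min > 0`, a cut-off VALUE `|ζ| ≤ Z_b`, a state
`ρ ≥ 0` whose pressure obeys `|p(ρ,ϑ(ρ,E))| ≤ c_g E`, and any `R ≥ 0` with `1 + ρ + E ≤ E_c R`:
`reducedRHS (fun _ => ζ) ≤ C (ρ∑vᵢ²/2 + R)` with the explicit constant of the tree's residual bound.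
[cite: BrezinaFeireisl2018, §3.2.2, (3.8), (3.1)] -/
theorem reducedRHS_le_far_const {d : StrongPointData} {M Pk Sk Zb cg Ec rmin ρ E R ζ : ℝ}
    {m : EuclideanSpace ℝ (Fin 3)}
    (hM : 0 ≤ M) (hPk0 : 0 ≤ Pk) (hSk0 : 0 ≤ Sk) (hZb0 : 0 ≤ Zb) (hcg : 0 ≤ cg) (hEc : 0 ≤ Ec)
    (hrmin : 0 < rmin) (hr : rmin ≤ d.r) (hρ : 0 ≤ ρ) (hE : 0 ≤ E) (hB : d.Bounded M)
    (hPk : |eos.p d.r d.Θ| ≤ Pk) (hSk : |eos.s d.r d.Θ| ≤ Sk)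
    (hpρ : |d.pρ eos| ≤ Sk) (hpϑ : |d.pϑ eos| ≤ Sk) (hζ : |ζ| ≤ Zb)
    (hgrowth : |eos.p ρ (stateTemp eos ρ E)| ≤ cg * E)
    (hR : 0 ≤ R) (hGR : 1 + ρ + E ≤ Ec * R) :
    reducedRHS eos (fun _ => ζ) d ρ E m ≤
      (2 * (3 * M + (Sk + Zb) * M / 2) +
        ((3 * M * Pk + 3 * M * cg) + 2 * Sk * (M + 3 * M * M) * (1 / rmin + 1) +
          (Sk + Zb) * (M + 3 * M * M) + 3 / 2 * (Sk + Zb) * M) * Ec) *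
        (ρ * (∑ i, (m i / ρ - d.U i) ^ 2) / 2 + R) := by
  have hr0 : 0 < d.r := hrmin.trans_le hr
  obtain ⟨G, hGdef⟩ : ∃ G, G = 1 + ρ + E := ⟨_, rfl⟩
  rw [← hGdef] at hGR
  have hG1 : 1 ≤ G := by rw [hGdef]; linarith
  have hG0 : 0 ≤ G := zero_le_one.trans hG1
  have hρG : ρ ≤ G := by rw [hGdef]; linarith
  have hEG : E ≤ G := by rw [hGdef]; linarith
  have hD0 : 0 ≤ M + 3 * M * M := by positivity
  have hdiv := hB.abs_divU_le
  have hDt := hB.abs_DtΘ_le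
  have hDr := hB.abs_Dtr_le
  have hsZ : |eos.s d.r d.Θ - ζ| ≤ Sk + Zb := (abs_sub _ _).trans (add_le_add hSk hζ)
  unfold reducedRHS
  refine residual_combine (B₂ := 3 * M * Pk + 3 * M * cg)
    (B₃ := 2 * Sk * (M + 3 * M * M) * (1 / rmin + 1)) (B₄ := (Sk + Zb) * (M + 3 * M * M))
    (K := ρ * ∑ i, (m i / ρ - d.U i) ^ 2)
    hM (by positivity : 0 ≤ Sk + Zb) (by positivity) (by positivity) (by positivity)
    hEc (by positivity) hR hρG hGR ?_ ?_ ?_ ?_ ?_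
  · exact bound_quad hB.2.2.2.2.2.2 hM hρ
  · -- pressure term
    have h1 : |eos.p d.r d.Θ - eos.p ρ (stateTemp eos ρ E)| ≤ Pk + cg * E :=
      (abs_sub _ _).trans (add_le_add hPk hgrowth)
    have h2 : Pk + cg * E ≤ (Pk + cg) * G := by
      have e1 : Pk ≤ Pk * G := le_mul_of_one_le_right hPk0 hG1
      have e2 : cg * E ≤ cg * G := mul_le_mul_of_nonneg_left hEG hcg
      have e3 : (Pk + cg) * G = Pk * G + cg * G := by ring
      rw [e3]; linarith
    calc _ ≤ (Pk + cg) * G * (3 * M) := abs_mul_le_of_le (h1.trans h2) hdiv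
      _ = _ := by ring
  · -- material derivative of the pressure
    rw [pt_add_sum]
    have h1 : |(ρ - d.r) / d.r| ≤ ρ / rmin + 1 := by
      rw [abs_div, abs_of_pos hr0, div_le_iff₀ hr0]
      refine (abs_sub _ _).trans ?_
      rw [abs_of_nonneg hρ, abs_of_pos hr0, add_mul, one_mul]
      have : ρ ≤ ρ / rmin * d.r := by
        rw [div_mul_eq_mul_div, le_div_iff₀ hrmin]
        exact mul_le_mul_of_nonneg_left hr hρ
      linarith
    have h2 : |d.pρ eos * d.Dtr + d.pϑ eos * d.DtΘ| ≤ 2 * Sk * (M + 3 * M * M) := by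
      refine (abs_add_le _ _).trans ?_
      have e1 := abs_mul_le_of_le hpρ hDr
      have e2 := abs_mul_le_of_le hpϑ hDt
      linarith
    have h3 : ρ / rmin + 1 ≤ (1 / rmin + 1) * G := by
      have e1 : ρ / rmin ≤ 1 / rmin * G := by
        rw [one_div, ← div_eq_inv_mul]
        exact div_le_div_of_nonneg_right hρG hrmin.le
      have e2 : (1 / rmin + 1) * G = 1 / rmin * G + G := by ring
      rw [e2]; linarith
    calc _ ≤ (1 / rmin + 1) * G * (2 * Sk * (M + 3 * M * M)) := abs_mul_le_of_le (h1.trans h3) h2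
      _ = _ := by ring
  · -- entropy production against `DₜΘ`
    calc _ ≤ G * (Sk + Zb) * (M + 3 * M * M) := by
          rw [abs_mul, abs_mul, abs_of_nonneg hρ]
          exact mul_le_mul (mul_le_mul hρG hsZ (abs_nonneg _) hG0) hDt (abs_nonneg _)
            (by positivity)
      _ = _ := by ring
  · exact bound_transport_res hB.2.2.2.2.2.1 hM hρ hsZ

/-- **Coercive form of the clamped relative energy with a low cut-off value.** If `ρ > 0`, `E ≥ 0`,
`−μ(r,Θ) − Θζ ≥ 1` and `p(r,Θ) ≥ p₀ > 0`, then with `R := ℰ_ζ − ρ∑vᵢ²/2` one has `0 ≤ R` and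
`1 + ρ + E ≤ max 1 (1/p₀) · R`. [cite: BrezinaFeireisl2018, (3.8)] -/
theorem far_const_coercive (d : StrongPointData) {ζ ρ E p₀ : ℝ} (hρ : 0 < ρ) (hE : 0 ≤ E)
    (hμ : 1 ≤ -eos.chemPotential d.r d.Θ - d.Θ * ζ) (hp₀ : 0 < p₀) (hp : p₀ ≤ eos.p d.r d.Θ)
    (m : EuclideanSpace ℝ (Fin 3)) :
    0 ≤ d.relEnergyZ eos (fun _ => ζ) (ρ, E, m) - ρ * (∑ i, (m i / ρ - d.U i) ^ 2) / 2 ∧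
    1 + ρ + E ≤ max 1 (1 / p₀) *
      (d.relEnergyZ eos (fun _ => ζ) (ρ, E, m) - ρ * (∑ i, (m i / ρ - d.U i) ^ 2) / 2) := by
  rw [relEnergyZ_const_kinetic_form d ζ hρ.ne' E m, kinetic_rel_eq d hρ.ne' m]
  have e : ρ * (∑ i, (m i / ρ - d.U i) ^ 2) / 2 + E +
      ρ * (-eos.chemPotential d.r d.Θ - d.Θ * ζ) + eos.p d.r d.Θ -
      ρ * (∑ i, (m i / ρ - d.U i) ^ 2) / 2 =
      E + ρ * (-eos.chemPotential d.r d.Θ - d.Θ * ζ) + eos.p d.r d.Θ := by ring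
  rw [e]
  have h1 : ρ * 1 ≤ ρ * (-eos.chemPotential d.r d.Θ - d.Θ * ζ) := mul_le_mul_of_nonneg_left hμ hρ.le
  have hm1 : (1 : ℝ) ≤ max 1 (1 / p₀) := le_max_left _ _
  have hm2 : 1 ≤ max 1 (1 / p₀) * p₀ := by
    have : 1 / p₀ * p₀ = 1 := by field_simp
    calc (1 : ℝ) = 1 / p₀ * p₀ := this.symm
      _ ≤ max 1 (1 / p₀) * p₀ := mul_le_mul_of_nonneg_right (le_max_right _ _) hp₀.le
  constructor
  · nlinarith
  · have h2 : ρ + E ≤ max 1 (1 / p₀) * (ρ + E) := le_mul_of_one_le_left (by positivity) hm1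
    have h3 : max 1 (1 / p₀) * p₀ ≤ max 1 (1 / p₀) * eos.p d.r d.Θ :=
      mul_le_mul_of_nonneg_left hp (le_trans zero_le_one hm1)
    nlinarith

/-- REGISTERED SUB-GOAL `stub_bf18ShellFar` of the line `Sketch` (helper 3a of `stub_bf18Shell`): the linear
coercivity of the clamped relative energy with a low constant cut-off value. [cite: BrezinaFeireisl2018, (3.8)] -/
theorem stub_bf18ShellFar :
    ∀ (eos : EulerEOS) (d : StrongPointData) (ζ ρ E p₀ : ℝ) (m : EuclideanSpace ℝ (Fin 3)),
      0 < ρ → 0 ≤ E → 1 ≤ -eos.chemPotential d.r d.Θ - d.Θ * ζ → 0 < p₀ → p₀ ≤ eos.p d.r d.Θ →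
      0 ≤ d.relEnergyZ eos (fun _ => ζ) (ρ, E, m) - ρ * (∑ i, (m i / ρ - d.U i) ^ 2) / 2 ∧
      1 + ρ + E ≤ max 1 (1 / p₀) *
        (d.relEnergyZ eos (fun _ => ζ) (ρ, E, m) - ρ * (∑ i, (m i / ρ - d.U i) ^ 2) / 2) :=
  fun _eos d _ζ _ρ _E _p₀ m hρ hE hμ hp₀ hp => far_const_coercive d hρ hE hμ hp₀ hp m

end Summit.AtomisticToContinuum.HydrodynamicLimit.Theorems.ChaosClosesEulerShell
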